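import Summits.NavierStokesRegularity.NavierStokesRegularity.Theorems.PerpetualPumpCircuitPumpPhaseThreeClock

/-!
# `PerpetualPump.CircuitPump` (stmt-NavierStokesRegularity-1834), line `singular-clock-gspt`:
# the active-block clock (phase matching of the new bond)

Sub-goal `toda_active_clock` of `stub_clockBox` (Toda `m = 2` instance). After the transfer gate the
new carrier decays freely, `w = W e^{-ν(t-t₃)} ± 30` with `W = A - ℓ₁ ± (903 + 50 log A)`
(`ℓ₁ = Λ/2 + log (A/8)`, `Λ = -log ε`), and the new bond `z` grows at rate `lam (w - y) - ν` with seed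
`ε lam w²` from `log z(t₃) ∈ [log ε + log A, log ε + 27 log A + 400]`. By the (landed) phase III clock
`toda_phase3_clock`, after a time shift, `log (z(t)/z(t₃)) = G_W(t - t₃) + O(log A)` with
`G_W(s) = lam W (1 - e^{-νs})/ν`; inverting `G` explicitly locates the phase match `z = √ε/q`
(`q = lam^{1/5}`) strictly inside the window `(t₃ + Δ⁻, t₃ + Δ⁺)`, and at a phase-matched time the
identity `W e^{-νs} = W - (ν/lam) G_W(s)` together with `q ν = lam` gives the affine clock law
`|q w - (q A - (q+1) Λ/2)| ≤ 1500 + 85 log A`. Pure real analysis. [folklore]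
-/

set_option linter.dupNamespace false

noncomputable section

open Set

namespace Summit.NavierStokesRegularity.NavierStokesRegularity.Theorems.PerpetualPumpCircuitPump

open Literature.Analysis.ODE

/-- Numerology of the exponents: `ν = lam^{4/5} ∈ (1, 3/2]`, `q = lam^{1/5} ∈ (1, 1.09]`, `q ν = lam`,
`log q ∈ [0, 1/10]`. [folklore] -/
theorem activeClock_consts {lam ν q : ℝ} (hlam : 1 < lam) (hlam2 : lam ≤ 3 / 2)
    (hν : ν = lam ^ (4 / 5 : ℝ)) (hq : q = lam ^ (1 / 5 : ℝ)) :
    1 < ν ∧ ν ≤ 3 / 2 ∧ 1 < q ∧ q ≤ 109 / 100 ∧ q * ν = lam ∧ 0 ≤ Real.log q ∧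
      Real.log q ≤ 1 / 10 := by
  have hlam0 : 0 < lam := by linarith
  refine ⟨?_, ?_, ?_, ?_, ?_, ?_, ?_⟩
  · rw [hν]; exact Real.one_lt_rpow hlam (by norm_num)
  · rw [hν]
    calc lam ^ (4 / 5 : ℝ) ≤ lam ^ (1 : ℝ) := Real.rpow_le_rpow_of_exponent_le hlam.le (by norm_num)
      _ ≤ 3 / 2 := by rw [Real.rpow_one]; exact hlam2
  · rw [hq]; exact Real.one_lt_rpow hlam (by norm_num)
  · rw [hq, one_div, Real.rpow_inv_le_iff_of_pos hlam0.le (by norm_num) (by norm_num)]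
    have e : (109 / 100 : ℝ) ^ (5 : ℝ) = (109 / 100) ^ (5 : ℕ) := by
      rw [show (5 : ℝ) = ((5 : ℕ) : ℝ) by norm_num, Real.rpow_natCast]
    rw [e]; norm_num; linarith
  · rw [hq, hν, ← Real.rpow_add hlam0]; norm_num
  · rw [hq]; exact Real.log_nonneg (Real.one_le_rpow hlam.le (by norm_num))
  · rw [hq, Real.log_rpow hlam0]
    have := Real.log_le_sub_one_of_pos hlam0
    linarith

/-- `log A ≤ 10 + A/40000` for `A ≥ 40000`, in the form used below. [folklore] -/
theorem activeClock_logA {A : ℝ} (hA : 40000 ≤ A) :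
    0 < Real.log A ∧ 51 * Real.log A + 903 ≤ A / 25 := by
  have h1 : Real.log A = Real.log 40000 + Real.log (A / 40000) := by
    rw [← Real.log_mul (by norm_num) (by positivity)]; congr 1; ring
  have h2 := Real.log_le_sub_one_of_pos (show 0 < A / 40000 by positivity)
  have h3 : Real.log 40000 ≤ 11 := by
    rw [Real.log_le_iff_le_exp (by norm_num)]
    have h := Real.exp_one_gt_d9
    have e : Real.exp (11 : ℝ) = Real.exp 1 ^ 11 := by
      rw [show (11 : ℝ) = ((11 : ℕ) : ℝ) * 1 by norm_num, Real.exp_nat_mul]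
    rw [e]
    calc (40000 : ℝ) ≤ 2.7 ^ 11 := by norm_num
      _ ≤ _ := pow_le_pow_left₀ (by norm_num) (by linarith) 11
  exact ⟨Real.log_pos (by linarith), by rw [h1]; linarith⟩

/-- The bracket of the carrier amplitude `W = A - ℓ₁ ± (903 + 50 log A)`: `0.86 A ≤ W⁻ ≤ W ≤ W⁺` and
`W⁺ + 30 ≤ 1.05 A`; also `0 ≤ log (A/8) ≤ log A` and `log ε ≤ 0`. [folklore] -/
theorem activeClock_W {ε A W : ℝ} (hε : 0 < ε) (hA : 40000 ≤ A) (hΛ : -Real.log ε ≤ A / 5)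
    (hεA : ε * (A + 2) ^ 2 ≤ 1)
    (hW : |W - (A - (-(Real.log ε) / 2 + Real.log (A / 8)))| ≤ 903 + 50 * Real.log A) :
    Real.log ε ≤ 0 ∧ 0 ≤ Real.log (A / 8) ∧ Real.log (A / 8) ≤ Real.log A ∧
    43 * A / 50 ≤ A - (-(Real.log ε) / 2 + Real.log (A / 8)) - 903 - 50 * Real.log A ∧
    A - (-(Real.log ε) / 2 + Real.log (A / 8)) - 903 - 50 * Real.log A ≤ W ∧
    W ≤ A - (-(Real.log ε) / 2 + Real.log (A / 8)) + 903 + 50 * Real.log A ∧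
    A - (-(Real.log ε) / 2 + Real.log (A / 8)) + 903 + 50 * Real.log A + 30 ≤ 21 * A / 20 := by
  obtain ⟨hlogA, hlin⟩ := activeClock_logA hA
  have hε1 : ε ≤ 1 := by nlinarith
  have hlε : Real.log ε ≤ 0 := Real.log_nonpos hε.le hε1
  have h8 : 0 ≤ Real.log (A / 8) := Real.log_nonneg (by linarith)
  have h8' : Real.log (A / 8) ≤ Real.log A := Real.log_le_log (by positivity) (by linarith)
  have hW' := abs_le.mp hW
  refine ⟨hlε, h8, h8', by linarith, by linarith, by linarith, by linarith⟩

/-- Explicit inversion of the clock profile: for `Δ = -(1/ν) log (1 - ν c/(lam V))` with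
`ν c < lam V` (`ν, lam, V > 0`) one has `e^{-νΔ} = 1 - ν c/(lam V)` and `lam V (1 - e^{-νΔ})/ν = c`.
[folklore] -/
theorem activeClock_invert {lam ν V c : ℝ} (hν : 0 < ν) (hlam : 0 < lam) (hV : 0 < V)
    (hc : ν * c < lam * V) :
    Real.exp (-ν * (-(1 / ν) * Real.log (1 - ν * c / (lam * V)))) = 1 - ν * c / (lam * V) ∧
    lam * V * (1 - Real.exp (-ν * (-(1 / ν) * Real.log (1 - ν * c / (lam * V))))) / ν = c := by
  have hD : 0 < lam * V := mul_pos hlam hV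
  have hx : 0 < 1 - ν * c / (lam * V) := by rw [sub_pos, div_lt_one hD]; exact hc
  have h1 : -ν * (-(1 / ν) * Real.log (1 - ν * c / (lam * V))) =
      Real.log (1 - ν * c / (lam * V)) := by field_simp
  rw [h1, Real.exp_log hx]
  refine ⟨rfl, ?_⟩
  field_simp
  ring

/-- Before the window: if `0 ≤ s ≤ Δ = -(1/ν) log (1 - ν c/(lam V))` (`ν c < lam V`, `W ≤ V`), then
`G_W(s) = lam W (1 - e^{-ν s})/ν ≤ c`. [folklore] -/
theorem activeClock_G_le {lam ν V W c s Δ : ℝ} (hν : 0 < ν) (hlam : 0 < lam) (hV : 0 < V)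
    (hc : ν * c < lam * V) (hWV : W ≤ V) (hs : 0 ≤ s)
    (hΔ : Δ = -(1 / ν) * Real.log (1 - ν * c / (lam * V))) (hsΔ : s ≤ Δ) :
    lam * W * (1 - Real.exp (-ν * s)) / ν ≤ c := by
  obtain ⟨hex, hGc⟩ := activeClock_invert hν hlam hV hc
  rw [← hΔ] at hex hGc
  have h1 : Real.exp (-ν * Δ) ≤ Real.exp (-ν * s) :=
    Real.exp_le_exp.mpr (by nlinarith)
  have h2 : Real.exp (-ν * s) ≤ 1 := by rw [Real.exp_le_one_iff]; nlinarith
  calc lam * W * (1 - Real.exp (-ν * s)) / ν ≤ lam * V * (1 - Real.exp (-ν * Δ)) / ν :=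
        div_le_div_of_nonneg_right (mul_le_mul (mul_le_mul_of_nonneg_left hWV hlam.le)
          (by linarith) (by linarith) (mul_pos hlam hV).le) hν.le
    _ = c := hGc

/-- After the window: `Δ = -(1/ν) log (1 - ν c/(lam V)) > 0` and `c ≤ G_W(Δ)` for `0 < c`,
`ν c < lam V`, `0 < V ≤ W`. [folklore] -/
theorem activeClock_le_G {lam ν V W c Δ : ℝ} (hν : 0 < ν) (hlam : 0 < lam) (hV : 0 < V)
    (hc0 : 0 < c) (hc : ν * c < lam * V) (hVW : V ≤ W)
    (hΔ : Δ = -(1 / ν) * Real.log (1 - ν * c / (lam * V))) :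
    0 < Δ ∧ c ≤ lam * W * (1 - Real.exp (-ν * Δ)) / ν := by
  obtain ⟨hex, hGc⟩ := activeClock_invert hν hlam hV hc
  rw [← hΔ] at hex hGc
  have hx0 : 0 < ν * c / (lam * V) := div_pos (mul_pos hν hc0) (mul_pos hlam hV)
  refine ⟨?_, ?_⟩
  · have hl : Real.log (1 - ν * c / (lam * V)) < 0 :=
      Real.log_neg (by rw [← hex]; exact Real.exp_pos _) (by linarith)
    rw [hΔ]; exact mul_pos_of_neg_of_neg (by have := one_div_pos.mpr hν; linarith) hl
  · calc c = lam * V * (1 - Real.exp (-ν * Δ)) / ν := hGc.symm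
      _ ≤ _ := div_le_div_of_nonneg_right (mul_le_mul_of_nonneg_right
          (mul_le_mul_of_nonneg_left hVW hlam.le) (by rw [hex]; linarith)) hν.le

/-- **The shifted phase III clock (★).** `toda_phase3_clock` applied to `s ↦ (w, z, y)(t₃ + s)` on
`[0, T - t₃]` with `Cw = 30`, `Y = 1`, seed `ε lam w² ≤ ε lam (21A/20)²`, and the error terms evaluated
(`T - t₃ ≤ 1/2`, `ν ≤ 3/2`, `z(t₃) ≥ ε A`): for `t ∈ [t₃, T]`,
`G_W(t - t₃) - 24 ≤ log z(t) - log z(t₃) ≤ G_W(t - t₃) + 48 + log A`. [folklore] -/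
theorem activeClock_star {lam ν ε A W T t₃ : ℝ} {w z y : ℝ → ℝ} (hlam : 1 < lam)
    (hlam2 : lam ≤ 3 / 2) (hν : ν = lam ^ (4 / 5 : ℝ)) (hε : 0 < ε) (hA : 40000 ≤ A)
    (htT : t₃ < T) (hT : T - t₃ ≤ 1 / 2) (hW0 : 0 < W) (hW1 : W + 30 ≤ 21 * A / 20)
    (hw : ContinuousOn w (Icc t₃ T)) (hz : ContinuousOn z (Icc t₃ T))
    (hy : ContinuousOn y (Icc t₃ T))
    (hz' : ∀ t ∈ Ico t₃ T, HasDerivWithinAt z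
      (z t * (lam * (w t - y t) - ν) + ε * lam * w t ^ 2) (Ici t) t)
    (hwW : ∀ t ∈ Icc t₃ T, |w t - W * Real.exp (-ν * (t - t₃))| ≤ 30)
    (hyY : ∀ t ∈ Icc t₃ T, |y t| ≤ 1) (hz0 : 0 < z t₃)
    (hzlo : Real.log ε + Real.log A ≤ Real.log (z t₃)) :
    ∀ t ∈ Icc t₃ T, 0 < z t ∧
      lam * W * (1 - Real.exp (-ν * (t - t₃))) / ν - 24 ≤ Real.log (z t) - Real.log (z t₃) ∧
      Real.log (z t) - Real.log (z t₃) ≤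
        lam * W * (1 - Real.exp (-ν * (t - t₃))) / ν + 48 + Real.log A := by
  intro t ht
  have hν1 : 1 < ν := by rw [hν]; exact Real.one_lt_rpow hlam (by norm_num)
  have hν2 : ν ≤ 3 / 2 := by
    rw [hν]
    calc lam ^ (4 / 5 : ℝ) ≤ lam ^ (1 : ℝ) := Real.rpow_le_rpow_of_exponent_le hlam.le (by norm_num)
      _ ≤ 3 / 2 := by rw [Real.rpow_one]; exact hlam2
  have hlam0 : 0 < lam := by linarith
  have hA0 : 0 < A := by linarith
  have hmaps : MapsTo (fun s : ℝ => t₃ + s) (Icc 0 (T - t₃)) (Icc t₃ T) := fun s hs =>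
    ⟨by linarith [hs.1], by linarith [hs.2]⟩
  have hsh : ContinuousOn (fun s : ℝ => t₃ + s) (Icc 0 (T - t₃)) :=
    continuousOn_const.add continuousOn_id
  have hw₀ : ContinuousOn (fun s => w (t₃ + s)) (Icc 0 (T - t₃)) := hw.comp hsh hmaps
  have hz₀ : ContinuousOn (fun s => z (t₃ + s)) (Icc 0 (T - t₃)) := hz.comp hsh hmaps
  have hy₀ : ContinuousOn (fun s => y (t₃ + s)) (Icc 0 (T - t₃)) := hy.comp hsh hmaps
  have hs₁ : ContinuousOn (fun s => ε * lam * w (t₃ + s) ^ 2) (Icc 0 (T - t₃)) :=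
    continuousOn_const.mul (hw₀.pow 2)
  have hz₀' : ∀ s ∈ Ico 0 (T - t₃), HasDerivWithinAt (fun s => z (t₃ + s))
      (z (t₃ + s) * (lam * (w (t₃ + s) - y (t₃ + s)) - ν) + ε * lam * w (t₃ + s) ^ 2)
      (Ici s) s := by
    intro s hs
    have h1 := hz' (t₃ + s) ⟨by linarith [hs.1], by linarith [hs.2]⟩
    have h2 : HasDerivWithinAt (fun s : ℝ => t₃ + s) 1 (Ici s) s :=
      ((hasDerivAt_id' s).const_add t₃).hasDerivWithinAt
    have h3 := h1.comp s h2 (fun x (hx : s ≤ x) => show t₃ + s ≤ t₃ + x by linarith)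
    simpa [Function.comp_def] using h3
  have he1 : ∀ s ∈ Icc 0 (T - t₃), Real.exp (-ν * s) ≤ 1 := fun s hs => by
    rw [Real.exp_le_one_iff]; nlinarith [hs.1]
  have hwW₀ : ∀ s ∈ Icc 0 (T - t₃), |w (t₃ + s) - W * Real.exp (-ν * s)| ≤ 30 := by
    intro s hs
    simpa [add_sub_cancel_left] using hwW (t₃ + s) (hmaps hs)
  have hyY₀ : ∀ s ∈ Icc 0 (T - t₃), |y (t₃ + s)| ≤ 1 := fun s hs => hyY (t₃ + s) (hmaps hs)
  have hs₁b : ∀ s ∈ Icc 0 (T - t₃), 0 ≤ ε * lam * w (t₃ + s) ^ 2 ∧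
      ε * lam * w (t₃ + s) ^ 2 ≤ ε * lam * (21 * A / 20) ^ 2 := by
    intro s hs
    refine ⟨by positivity, mul_le_mul_of_nonneg_left ?_ (by positivity)⟩
    have h1 := abs_le.mp (hwW₀ s hs)
    have h2 : W * Real.exp (-ν * s) ≤ W := mul_le_of_le_one_right hW0.le (he1 s hs)
    have h3 : 0 ≤ W * Real.exp (-ν * s) := by positivity
    apply sq_le_sq' <;> linarith
  have hzA : ε * A ≤ z t₃ := by
    rw [← Real.log_le_log_iff (by positivity) hz0, Real.log_mul hε.ne' hA0.ne']; exact hzlo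
  have hs : t - t₃ ∈ Icc 0 (T - t₃) := ⟨by linarith [ht.1], by linarith [ht.2]⟩
  have key := toda_phase3_clock lam ν W 30 1 (ε * lam * (21 * A / 20) ^ 2) (T - t₃)
    (fun s => w (t₃ + s)) (fun s => z (t₃ + s)) (fun s => y (t₃ + s))
    (fun s => ε * lam * w (t₃ + s) ^ 2) hlam (by linarith) hν (by norm_num) (by norm_num)
    (by positivity) (by linarith) hW0 (by simpa using hz0) hw₀ hz₀ hy₀ hs₁ hz₀' hwW₀ hyY₀ hs₁b
    (t - t₃) hs
  simp only [add_sub_cancel, add_zero] at key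
  obtain ⟨hzt, hlo, hhi⟩ := key
  rw [Real.log_div hzt.ne' hz0.ne'] at hlo hhi
  have hνs : ν * (t - t₃) ≤ 3 / 4 := by nlinarith [hs.1, hs.2]
  have hνs0 : 0 ≤ ν * (t - t₃) := by nlinarith [hs.1, hs.2]
  have hls : lam * (30 + 1) * (t - t₃) ≤ 93 / 4 := by nlinarith [hs.1, hs.2]
  refine ⟨hzt, by linarith, ?_⟩
  -- the seed correction is at most `24 + log A`
  have hE : Real.exp ((ν + lam * (30 + 1)) * (t - t₃)) ≤ Real.exp 24 := by
    apply Real.exp_le_exp.mpr; nlinarith [hs.1, hs.2]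
  set E := Real.exp ((ν + lam * (30 + 1)) * (t - t₃)) with hEdef
  have hE0 : 0 < E := Real.exp_pos _
  have hX : ε * lam * (21 * A / 20) ^ 2 * (t - t₃) * E / z t₃ ≤
      (3 / 2 * (441 / 400) * A) * (1 / 2 * Real.exp 24) := by
    calc ε * lam * (21 * A / 20) ^ 2 * (t - t₃) * E / z t₃
        ≤ ε * lam * (21 * A / 20) ^ 2 * (t - t₃) * E / (ε * A) :=
          div_le_div_of_nonneg_left (by have := hs.1; positivity) (by positivity) hzA
      _ = (lam * (441 / 400) * A) * ((t - t₃) * E) := by field_simp; ring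
      _ ≤ (3 / 2 * (441 / 400) * A) * (1 / 2 * Real.exp 24) :=
          mul_le_mul (by nlinarith) (mul_le_mul (hs.2.trans hT) hE hE0.le (by norm_num))
            (by have := hs.1; positivity) (by positivity)
  have h24 : (1 : ℝ) ≤ Real.exp 24 := Real.one_le_exp (by norm_num)
  have hlog : Real.log (1 + ε * lam * (21 * A / 20) ^ 2 * (t - t₃) * E / z t₃) ≤
      24 + Real.log A := by
    have hpos : 0 < 1 + ε * lam * (21 * A / 20) ^ 2 * (t - t₃) * E / z t₃ := by
      have := hs.1; positivity
    calc Real.log (1 + ε * lam * (21 * A / 20) ^ 2 * (t - t₃) * E / z t₃)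
        ≤ Real.log (A * Real.exp 24) := Real.log_le_log hpos (by nlinarith)
      _ = 24 + Real.log A := by
          rw [Real.log_mul hA0.ne' (Real.exp_pos _).ne', Real.log_exp]; ring
  linarith

/-- The new bond is non-decreasing on `[t₃, T]`: its rate `lam (w - y) - ν` is positive there
(`w - y ≥ W e^{-ν(t-t₃)} - 31 ≥ W/4 - 31 > 0`, `W ≥ 0.86 A`) and the seed is non-negative. [folklore] -/
theorem activeClock_mono {lam ν ε A W T t₃ : ℝ} {w z y : ℝ → ℝ} (hlam : 1 ≤ lam)
    (hν2 : ν ≤ 3 / 2) (hε : 0 ≤ ε) (hA : 40000 ≤ A) (hT : T - t₃ ≤ 1 / 2) (hWlo : 43 * A / 50 ≤ W)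
    (hz : ContinuousOn z (Icc t₃ T))
    (hz' : ∀ t ∈ Ico t₃ T, HasDerivWithinAt z
      (z t * (lam * (w t - y t) - ν) + ε * lam * w t ^ 2) (Ici t) t)
    (hwW : ∀ t ∈ Icc t₃ T, |w t - W * Real.exp (-ν * (t - t₃))| ≤ 30)
    (hyY : ∀ t ∈ Icc t₃ T, |y t| ≤ 1) (hzp : ∀ t ∈ Icc t₃ T, 0 < z t) :
    ∀ a ∈ Icc t₃ T, ∀ b ∈ Icc a T, z a ≤ z b := by
  intro a ha b hb
  refine le_of_deriv_right_nonneg (hz.mono (Icc_subset_Icc_left ha.1))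
    (fun x hx => hz' x ⟨ha.1.trans hx.1, hx.2⟩) (fun x hx => ?_) b hb
  have hxI : x ∈ Icc t₃ T := ⟨ha.1.trans hx.1, hx.2.le⟩
  have h1 := abs_le.mp (hwW x hxI)
  have h2 := abs_le.mp (hyY x hxI)
  have hνx : ν * (x - t₃) ≤ 3 / 4 := by
    nlinarith [mul_le_mul hν2 (show x - t₃ ≤ 1 / 2 by linarith [hxI.2]) (by linarith [hxI.1])
      (by norm_num : (0 : ℝ) ≤ 3 / 2)]
  have he : 1 / 4 ≤ Real.exp (-ν * (x - t₃)) := by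
    have := Real.add_one_le_exp (-ν * (x - t₃)); linarith
  have hWe : W / 4 ≤ W * Real.exp (-ν * (x - t₃)) := by nlinarith
  have hwy : 2 ≤ w x - y x := by linarith
  have hrate : 0 ≤ lam * (w x - y x) - ν := by nlinarith
  exact add_nonneg (mul_nonneg (hzp x hxI).le hrate) (by positivity)

/-- **ACTIVE-BLOCK CLOCK (phase matching).** From the outputs (iv)–(vi) of `toda_active_core` — new
carrier `w` tracked by `W e^{−ν(t−t₃)} ± 30` with `W = A − ℓ₁ ± (903 + 50 log A)`, new bond `z`
started at `log z(t₃) ∈ [log ε + log A, log ε + 27 log A + 400]` and obeying its growth law with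
`|y| ≤ 1` — the PHASE MATCH `z = √ε/q` (`q = lam^{1/5}`; the pinned section value of the next scale)
happens inside the explicit window `[t₃ + Δ⁻, t₃ + Δ⁺]` (`Δ∓` obtained by inverting
`Δ ↦ lam W (1 − e^{−νΔ})/ν` explicitly with a `log`), strictly after `t₃ + Δ⁻` and strictly before
`t₃ + Δ⁺` (`z` is increasing), and AT ANY PHASE-MATCHED TIME THE RENORMALISED NEW AMPLITUDE IS AFFINE IN
`A`: `|q w − (q A − (q+1)Λ/2)| ≤ 1500 + 85 log A` (`Λ = −log ε`; uses `q ν = lam`) — the pump's clock law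
with its `O(log)` error, from `toda_phase3_clock`. -/
theorem toda_active_clock :
    ∀ (lam ν q ε A W T t₃ : ℝ) (w z y : ℝ → ℝ),
    1 < lam → lam ≤ 3 / 2 → ν = lam ^ (4 / 5 : ℝ) → q = lam ^ (1 / 5 : ℝ) → 0 < ε →
    40000 ≤ A → -Real.log ε ≤ A / 5 → ε * (A + 2) ^ 2 ≤ 1 →
    0 ≤ t₃ → t₃ < T → T ≤ 1 / 2 →
    |W - (A - (-(Real.log ε) / 2 + Real.log (A / 8)))| ≤ 903 + 50 * Real.log A →
    ContinuousOn w (Set.Icc t₃ T) → ContinuousOn z (Set.Icc t₃ T) → ContinuousOn y (Set.Icc t₃ T) →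
    (∀ t ∈ Set.Ico t₃ T, HasDerivWithinAt z
      (z t * (lam * (w t - y t) - ν) + ε * lam * w t ^ 2) (Set.Ici t) t) →
    (∀ t ∈ Set.Icc t₃ T, |w t - W * Real.exp (-ν * (t - t₃))| ≤ 30) →
    (∀ t ∈ Set.Icc t₃ T, |y t| ≤ 1) →
    0 < z t₃ → Real.log ε + Real.log A ≤ Real.log (z t₃) →
    Real.log (z t₃) ≤ Real.log ε + 27 * Real.log A + 400 →
    (∀ t ∈ Set.Icc t₃ T, z t = Real.sqrt ε / q →
      |q * w t - (q * A - (q + 1) * (-Real.log ε) / 2)| ≤ 1500 + 85 * Real.log A) ∧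
    (∀ t ∈ Set.Icc t₃ T,
      t - t₃ ≤ -(1 / ν) * Real.log (1 - ν * ((-Real.log ε) / 2 - Real.log q - 28 * Real.log A - 449) /
        (lam * (A - (-(Real.log ε) / 2 + Real.log (A / 8)) + 903 + 50 * Real.log A))) →
      z t < Real.sqrt ε / q) ∧
    (∀ t ∈ Set.Icc t₃ T,
      -(1 / ν) * Real.log (1 - ν * ((-Real.log ε) / 2 - Real.log q + 73) /
        (lam * (A - (-(Real.log ε) / 2 + Real.log (A / 8)) - 903 - 50 * Real.log A))) ≤ t - t₃ →
      Real.sqrt ε / q < z t) := by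
  intro lam ν q ε A W T t₃ w z y hlam hlam2 hν hq hε hA hΛ hεA ht₃ htT hT hW hw hz hy hz' hwW hyY
    hz0 hzlo hzhi
  obtain ⟨hν1, hν2, hq1, hq2, hqν, hlq0, hlq1⟩ := activeClock_consts hlam hlam2 hν hq
  obtain ⟨hlogA, _⟩ := activeClock_logA hA
  obtain ⟨hlε, h8, h8', hWm, hWlo, hWhi, hWp⟩ := activeClock_W hε hA hΛ hεA hW
  have hlam0 : 0 < lam := by linarith
  have hν0 : 0 < ν := by linarith
  have hq0 : 0 < q := by linarith
  have hW0 : 0 < W := by linarith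
  have star := activeClock_star hlam hlam2 hν hε hA htT (by linarith) hW0 (by linarith) hw hz hy hz'
    hwW hyY hz0 hzlo
  have hzp : ∀ t ∈ Icc t₃ T, 0 < z t := fun t ht => (star t ht).1
  have mono := activeClock_mono hlam.le hν2 hε.le hA (by linarith) (by linarith) hz hz' hwW
    hyY hzp
  have hsq0 : 0 < Real.sqrt ε / q := div_pos (Real.sqrt_pos.mpr hε) hq0
  have hLq : Real.log (Real.sqrt ε / q) = Real.log ε / 2 - Real.log q := by
    rw [Real.log_div (Real.sqrt_ne_zero'.mpr hε) hq0.ne', Real.log_sqrt hε.le]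
  refine ⟨?_, ?_, ?_⟩
  · -- (a) the affine clock law at a phase-matched time
    intro t ht hzt
    obtain ⟨_, hlo, hhi⟩ := star t ht
    rw [hzt, hLq] at hlo hhi
    have hG : lam * W * (1 - Real.exp (-ν * (t - t₃))) / ν =
        q * W * (1 - Real.exp (-ν * (t - t₃))) := by
      rw [← hqν]; field_simp
    rw [hG] at hlo hhi
    have hd := abs_le.mp (hwW t ht)
    have hdW := abs_le.mp hW
    have hp1 := mul_nonneg hq0.le (sub_nonneg.mpr hd.1)
    have hp2 := mul_nonneg hq0.le (sub_nonneg.mpr hd.2)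
    have hp3 := mul_nonneg hq0.le (sub_nonneg.mpr hdW.1)
    have hp4 := mul_nonneg hq0.le (sub_nonneg.mpr hdW.2)
    have hp5 := mul_nonneg hq0.le h8
    have hp6 := mul_nonneg hq0.le (sub_nonneg.mpr h8')
    have hp7 := mul_nonneg (sub_nonneg.mpr hq2) hlogA.le
    have hp8 := mul_nonneg (sub_nonneg.mpr hq1.le) hlogA.le
    rw [abs_le]
    constructor <;> linarith
  · -- (b) before the window: `z < √ε/q`
    intro t ht
    generalize hΔ : -(1 / ν) * Real.log (1 - ν * ((-Real.log ε) / 2 - Real.log q -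
      28 * Real.log A - 449) / (lam * (A - (-(Real.log ε) / 2 + Real.log (A / 8)) + 903 +
      50 * Real.log A))) = Δ
    intro hle
    obtain ⟨hzt, _, hhi⟩ := star t ht
    rw [← Real.log_lt_log_iff hzt hsq0, hLq]
    have hV : 0 < A - (-(Real.log ε) / 2 + Real.log (A / 8)) + 903 + 50 * Real.log A := by
      linarith
    have hc1 : (-Real.log ε) / 2 - Real.log q - 28 * Real.log A - 449 ≤ A / 10 := by linarith
    have hc : ν * ((-Real.log ε) / 2 - Real.log q - 28 * Real.log A - 449) <
        lam * (A - (-(Real.log ε) / 2 + Real.log (A / 8)) + 903 + 50 * Real.log A) := by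
      linarith [mul_le_mul_of_nonneg_left hc1 hν0.le, mul_le_mul_of_nonneg_right hlam.le hV.le,
        mul_le_mul_of_nonneg_right hν2 (by positivity : (0 : ℝ) ≤ A / 10)]
    have hB := activeClock_G_le hν0 hlam0 hV hc hWhi (sub_nonneg.mpr ht.1) hΔ.symm hle
    linarith
  · -- (c) after the window: `√ε/q < z`
    intro t ht
    generalize hΔ : -(1 / ν) * Real.log (1 - ν * ((-Real.log ε) / 2 - Real.log q + 73) /
      (lam * (A - (-(Real.log ε) / 2 + Real.log (A / 8)) - 903 - 50 * Real.log A))) = Δ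
    intro hge
    have hV : 0 < A - (-(Real.log ε) / 2 + Real.log (A / 8)) - 903 - 50 * Real.log A := by
      linarith
    have hcpos : 0 < (-Real.log ε) / 2 - Real.log q + 73 := by linarith
    have hc1 : (-Real.log ε) / 2 - Real.log q + 73 ≤ A / 10 + 73 := by linarith
    have hc : ν * ((-Real.log ε) / 2 - Real.log q + 73) <
        lam * (A - (-(Real.log ε) / 2 + Real.log (A / 8)) - 903 - 50 * Real.log A) := by
      linarith [mul_le_mul_of_nonneg_left hc1 hν0.le, mul_le_mul_of_nonneg_right hlam.le hV.le,
        mul_le_mul_of_nonneg_right hν2 (by positivity : (0 : ℝ) ≤ A / 10 + 73)]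
    obtain ⟨hΔ0, hC⟩ := activeClock_le_G hν0 hlam0 hV hcpos hc hWlo hΔ.symm
    have ht' : t₃ + Δ ∈ Icc t₃ T := ⟨by linarith, by linarith [ht.2]⟩
    obtain ⟨hzt', hlo', _⟩ := star (t₃ + Δ) ht'
    rw [add_sub_cancel_left] at hlo'
    have hlt : Real.sqrt ε / q < z (t₃ + Δ) :=
      (Real.log_lt_log_iff hsq0 hzt').mp (by rw [hLq]; linarith)
    exact hlt.trans_le (mono (t₃ + Δ) ht' t ⟨by linarith, ht.2⟩)

end Summit.NavierStokesRegularity.NavierStokesRegularity.Theorems.PerpetualPumpCircuitPump
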